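import Summits.FinalStateConjecture.FinalStateConjecture.Statement
import Literature.Geometry.Lorentzian.MinkowskiGlobalHyperbolicity
import Literature.Geometry.Lorentzian.KerrConvergenceProofs
import Literature.Geometry.Lorentzian.CausalityPushUp

/-!
# The time-reversed flat chart on Minkowski spacetime — model for the negative lemma
# `WithoutFutureOrientation.lean` (crux `stmt-FinalStateConjecture-13551`, route `StarvedNecks`)

The crux `SeamedChartsExhaust` (`Theses/StarvedNecks.lean`) asserts, for every `C²` final-state
decomposition `d` of the self-determined exterior `O = J⁺(ι X) ∩ I⁻(d.charted)` of an MGHD, that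
`HonestCore(d, R₀)` (clauses (a)–(d)) and `SEAMED(d, R, R₀)` (clauses (1)–(12)) imply
`Summit.FinalStateConjecture.HasExhaustiveCharts d`. Its proof consumes the time direction of the flat
chart only through `HonestCore` (d) ("`dΦ(e₀)` is future-directed causal at flat-late points"). The sequel
`WithoutFutureOrientation.lean` proves that (d) cannot simply be dropped from the spacetime-level form of the statement
(`not_forall_hasExhaustiveCharts_without_futureOrientation` there): with `HonestCore` (a)–(c) and ALL twelve
SEAMED clauses kept verbatim, and `O = J⁺(Σ) ∩ I⁻(d.charted)` for an arbitrary set `Σ`, exhaustion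
fails in the following model, BUILT HERE. Minkowski spacetime `(ℝ⁴, η, ∂ₜ)` (`Minkowski.spacetime`), `Σ = ℝ⁴`,
`O = {x⁰ < 0}` (`= J⁺(ℝ⁴) ∩ I⁻(charted)`, `ReversedModel.O_eq`), no hole (`N = 0`), flat domain `⊤`,
flat chart the TIME REVERSAL `x ↦ (−x⁰, x̲)` after `τ₀ = 0` (`ReversedModel.decomp`): an exact
anti-chronous isometry of `η`, so every metric deviation vanishes (`ReversedModel.deviation_Φ`) and every
SEAMED clause holds (`ReversedModel` lemmas; the flat-late closed slabs are the closed half-spaces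
`{x⁰ ≤ −τ'}`), while at `τ₁ = 1` the point `p = (−1/2, 0) ∈ O` is neither flat-late after `1` (that region is
`{x⁰ < −1}`) nor in `J⁻(certified slab) = J⁻({x⁰ = −1}) = {x⁰ ≤ −1}`
(`ReversedModel.not_hasExhaustiveCharts_decomp`, by `Minkowski.causalPast_singleton`).

Scope note. In the route's own setting `Σ = ι(X)` is a Cauchy hypersurface and SEAMED (3) makes `dΦ(e₀)`
timelike on the connected flat-late region, which excludes a GLOBALLY reversed flat chart (its `e₀`-lines
would be past-directed timelike curves of unbounded length inside `J⁺(Σ)`); the model therefore shows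
exactly that the argument needs SOME clause fixing the time direction of the flat chart, and (d) is that
clause. Everything is `sorry`-free; no named fact is introduced (the dropped-clause statement is inlined).

References: B. O'Neill, *Semi-Riemannian geometry*, Academic Press 1983, Ch. 14, p. 402 (causality of
`ℝ⁴₁`; `Minkowski.causalPast_singleton` in the tree); M. Dafermos, G. Holzegel, I. Rodnianski, M. Taylor,
arXiv:2104.08222, §1 (late-time charts, `FinalStateDecomposition` in the tree).
-/

noncomputable section

open TopologicalSpace Manifold Filter Topology Set Function
open scoped ContDiff Topology ENNReal Manifold

namespace Summit.FinalStateConjecture.FinalStateConjecture.Theorems.SeamedChartsExhaust.Negative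

open Literature.Geometry.Lorentzian LorentzianMetric

namespace ReversedModel

/-- Time reversal `x ↦ (−x⁰, x̲)` of `E4`, as a continuous linear map. [folklore] -/
def T : E4 →L[ℝ] E4 :=
  ContinuousLinearMap.id ℝ E4 - (2 : ℝ) • (EuclideanSpace.proj (0 : Fin 4)).smulRight (E4.basisVector 0)

/-- Time reversal flips the sign of the time coordinate. [folklore] -/
@[simp] theorem T_apply_zero (x : E4) : T x 0 = -x 0 := by
  simp [T]; ring

/-- Time reversal fixes the spatial coordinates. [folklore] -/
@[simp] theorem T_apply_succ (x : E4) (i : Fin 3) : T x i.succ = x i.succ := by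
  simp [T, Fin.succ_ne_zero]

/-- Time reversal is an involution. [folklore] -/
theorem T_T (x : E4) : T (T x) = x := by
  ext i
  refine Fin.cases ?_ (fun j ↦ ?_) i
  · simp
  · simp

/-- `T` preserves the Minkowski form. [folklore] -/
theorem bilin_T (v w : E4) : Minkowski.bilin (T v) (T w) = Minkowski.bilin v w := by
  simp [Minkowski.bilin_apply]

/-- `T` as a continuous linear equivalence (it is an involution). [folklore] -/
def Tequiv : E4 ≃L[ℝ] E4 := ContinuousLinearEquiv.equivOfInverse T T T_T T_T

/-- Unfolding lemma for `Tequiv`. [folklore] -/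
@[simp] theorem Tequiv_apply (x : E4) : Tequiv x = T x := rfl

/-- The reversed flat chart on the whole of `E4`. -/
def Φ : (⊤ : Opens E4) → E4 := fun y ↦ T y.1

/-- The region: the open lower half-space `{x⁰ < 0}`. -/
def O : Set E4 := {x | x 0 < 0}

/-- The differential of the reversed flat chart is `T` (chain rule on the open submanifold `⊤ ⊆ E4`,
`mfderiv_comp_subtypeVal'`; Lee 2013, Prop. 3.9). [folklore] -/
theorem mfderiv_Φ_apply (y : (⊤ : Opens E4)) (v : E4) :
    mfderiv 𝓘(ℝ, E4) (𝓡 4) Φ y v = T v := by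
  have h1 : mfderiv 𝓘(ℝ, E4) 𝓘(ℝ, E4) Φ y = mfderiv 𝓘(ℝ, E4) 𝓘(ℝ, E4) (⇑T) y.1 :=
    mfderiv_comp_subtypeVal' (⇑T) y
  change mfderiv 𝓘(ℝ, E4) 𝓘(ℝ, E4) Φ y v = T v
  rw [h1, T.hasMFDerivAt.mfderiv]
  rfl

/-- The reversed chart is an exact isometry of `η`: its deviation vanishes. -/
theorem deviation_Φ (y : (⊤ : Opens E4)) :
    Minkowski.spacetime.deviation (Minkowski.backgroundOn ⊤) Φ y = 0 := by
  ext v w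
  change Minkowski.bilin (mfderiv 𝓘(ℝ, E4) (𝓡 4) Φ y v) (mfderiv 𝓘(ℝ, E4) (𝓡 4) Φ y w) -
    Minkowski.bilin v w = 0
  rw [mfderiv_Φ_apply, mfderiv_Φ_apply, bilin_T, sub_self]

/-- Hence the extended deviation of the reversed chart vanishes identically. [folklore] -/
theorem deviationExtend_Φ : Minkowski.spacetime.deviationExtend (Minkowski.backgroundOn ⊤) Φ = 0 := by
  funext y
  have := Minkowski.spacetime.deviationExtend_coe (Minkowski.backgroundOn ⊤) Φ ⟨y, trivial⟩
  rw [deviation_Φ] at this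
  exact this

/-- The reversed image of the flat late region `{x⁰ > τ}` is `{x⁰ < −τ}`. [folklore] -/
theorem image_Φ_lateRegion (τ : ℝ) :
    Φ '' (Minkowski.backgroundOn ⊤).lateRegion τ = {x : E4 | x 0 < -τ} := by
  ext x
  constructor
  · rintro ⟨y, hy, rfl⟩
    have hy' : τ < y.1 0 := hy
    show T y.1 0 < -τ
    rw [T_apply_zero]; linarith
  · intro hx
    refine ⟨⟨T x, trivial⟩, ?_, ?_⟩
    · show τ < T x 0
      rw [T_apply_zero]; have : x 0 < -τ := hx; linarith
    · show T (T x) = x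
      exact T_T x

/-- The reversed image of the flat slab `{x⁰ = τ}` is `{x⁰ = −τ}`. [folklore] -/
theorem image_Φ_timeSlab (τ : ℝ) :
    Φ '' (Minkowski.backgroundOn ⊤).timeSlab τ = {x : E4 | x 0 = -τ} := by
  ext x
  constructor
  · rintro ⟨y, hy, rfl⟩
    have hy' : y.1 0 = τ := hy
    show T y.1 0 = -τ
    rw [T_apply_zero, hy']
  · intro hx
    refine ⟨⟨T x, trivial⟩, ?_, ?_⟩
    · show T x 0 = τ
      rw [T_apply_zero]; have : x 0 = -τ := hx; linarith
    · show T (T x) = x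
      exact T_T x

/-- The reversed image of the closed flat-late slab `{x⁰ ≥ τ}` is `{x⁰ ≤ −τ}`. [folklore] -/
theorem image_Φ_ge (τ : ℝ) :
    Φ '' {y : (⊤ : Opens E4) | τ ≤ y.1 0} = {x : E4 | x 0 ≤ -τ} := by
  ext x
  constructor
  · rintro ⟨y, hy, rfl⟩
    have hy' : τ ≤ y.1 0 := hy
    show T y.1 0 ≤ -τ
    rw [T_apply_zero]; linarith
  · intro hx
    refine ⟨⟨T x, trivial⟩, ?_, ?_⟩
    · show τ ≤ T x 0
      rw [T_apply_zero]; have : x 0 ≤ -τ := hx; linarith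
    · show T (T x) = x
      exact T_T x

/-- A point of the chronological past of a set is in the causal past of a point of the set. -/
theorem exists_mem_causalPast_singleton_of_mem_chronologicalPast {S : Set E4} {x : E4}
    (hx : x ∈ Minkowski.spacetime.metric.chronologicalPast Minkowski.spacetime.timeOrientation S) :
    ∃ q ∈ S, x ∈ Minkowski.spacetime.metric.causalPast Minkowski.spacetime.timeOrientation {q} := by
  obtain ⟨q, hq, γ, a, b, hab, hγ, hγa, hγb⟩ := hx
  exact ⟨q, hq, Or.inr ⟨q, rfl, γ, a, b, hab, hγ.isFutureCausalCurveOn, hγa, hγb⟩⟩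

/-- A point of the causal past of a set is in the causal past of a point of the set. [folklore] -/
theorem exists_mem_causalPast_singleton_of_mem_causalPast {S : Set E4} {x : E4}
    (hx : x ∈ Minkowski.spacetime.metric.causalPast Minkowski.spacetime.timeOrientation S) :
    ∃ q ∈ S, x ∈ Minkowski.spacetime.metric.causalPast Minkowski.spacetime.timeOrientation {q} := by
  rcases hx with hx | ⟨q, hq, γ, a, b, hab, hγ, hγa, hγb⟩
  · exact ⟨x, hx, Or.inl rfl⟩
  · exact ⟨q, hq, Or.inr ⟨q, rfl, γ, a, b, hab, hγ, hγa, hγb⟩⟩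

/-- In Minkowski spacetime `x ∈ J⁻(q)` forces `x⁰ ≤ q⁰` (`Minkowski.causalPast_singleton`; O'Neill 1983,
Ch. 14, p. 402). [folklore] -/
theorem time_le_of_mem_causalPast_singleton {q x : E4}
    (h : x ∈ Minkowski.spacetime.metric.causalPast Minkowski.spacetime.timeOrientation {q}) : x 0 ≤ q 0 := by
  have h' : x ∈ {y : E4 | ‖E4.spatial q - E4.spatial y‖ ≤ q 0 - y 0} := by
    rw [← Minkowski.causalPast_singleton q]; exact h
  have := h'
  simp only [mem_setOf_eq] at this
  linarith [norm_nonneg (E4.spatial q - E4.spatial x)]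

/-- The vertical segment: `x ≪ x + s e₀` for `s > 0` in Minkowski spacetime. -/
theorem mem_chronologicalFuture_add_smul {x : E4} {s : ℝ} (hs : 0 < s) :
    x + s • E4.basisVector 0 ∈ Minkowski.spacetime.metric.chronologicalFuture Minkowski.spacetime.timeOrientation {x} := by
  refine ⟨x, rfl, fun σ : ℝ ↦ x + σ • (s • E4.basisVector 0), 0, 1, zero_lt_one, ?_, by simp, by simp⟩
  intro σ _
  set v : E4 := s • E4.basisVector 0 with hv_def
  have hγ : HasDerivAt (fun σ : ℝ ↦ x + σ • v) v σ := by
    simpa using ((hasDerivAt_id σ).smul_const v).const_add x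
  have hmd : MDifferentiableAt 𝓘(ℝ, ℝ) 𝓘(ℝ, E4) (fun σ : ℝ ↦ x + σ • v) σ :=
    mdifferentiableAt_iff_differentiableAt.mpr hγ.differentiableAt
  have hvel : velocity 𝓘(ℝ, E4) (fun σ : ℝ ↦ x + σ • v) σ = v := by
    unfold velocity
    rw [mfderiv_eq_fderiv]
    change fderiv ℝ (fun σ : ℝ ↦ x + σ • v) σ 1 = v
    rw [hγ.hasFDerivAt.fderiv]
    simp
  have hvv : Minkowski.bilin v v = -s ^ 2 := by
    rw [hv_def, Minkowski.bilin_apply]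
    simp [Fin.succ_ne_zero]; ring
  have hv0 : Minkowski.bilin (E4.basisVector 0) v = -s := by
    rw [Minkowski.bilin_basisVector_zero_left, hv_def]
    simp
  refine ⟨hmd, ?_, ⟨?_, ?_⟩, ?_⟩
  · change Minkowski.bilin (velocity 𝓘(ℝ, E4) (fun σ : ℝ ↦ x + σ • v) σ)
      (velocity 𝓘(ℝ, E4) (fun σ : ℝ ↦ x + σ • v) σ) < 0
    rw [hvel, hvv]; nlinarith
  · change Minkowski.bilin (velocity 𝓘(ℝ, E4) (fun σ : ℝ ↦ x + σ • v) σ)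
      (velocity 𝓘(ℝ, E4) (fun σ : ℝ ↦ x + σ • v) σ) ≤ 0
    rw [hvel, hvv]; nlinarith
  · change velocity 𝓘(ℝ, E4) (fun σ : ℝ ↦ x + σ • v) σ ≠ 0
    rw [hvel]
    intro h0
    have := congrArg (fun z : E4 ↦ z 0) h0
    simp [hv_def] at this
    exact hs.ne' this
  · change Minkowski.bilin (E4.basisVector 0) (velocity 𝓘(ℝ, E4) (fun σ : ℝ ↦ x + σ • v) σ) < 0
    rw [hvel, hv0]; linarith

/-- `I⁻({x⁰ < 0}) = {x⁰ < 0}` in Minkowski spacetime. -/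
theorem chronologicalPast_O :
    Minkowski.spacetime.metric.chronologicalPast Minkowski.spacetime.timeOrientation O = O := by
  refine Set.ext fun (x : E4) ↦ ⟨fun hx ↦ ?_, fun hx ↦ ?_⟩
  · obtain ⟨q, hq, hxq⟩ := exists_mem_causalPast_singleton_of_mem_chronologicalPast hx
    have := time_le_of_mem_causalPast_singleton hxq
    have hq' : q 0 < 0 := hq
    show x 0 < 0
    linarith
  · have hx' : x 0 < 0 := hx
    have hs : 0 < -(x 0) / 2 := by linarith
    have hmem : x + (-(x 0) / 2) • E4.basisVector 0 ∈ O := by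
      show (x + (-(x 0) / 2) • E4.basisVector 0) 0 < 0
      simp; linarith
    have h1 : x ∈ Minkowski.spacetime.metric.chronologicalPast Minkowski.spacetime.timeOrientation
        {x + (-(x 0) / 2) • E4.basisVector 0} :=
      mem_chronologicalPast_of_mem_chronologicalFuture (M := Minkowski.spacetime.carrier)
        (mem_chronologicalFuture_add_smul hs)
    show x ∈ Minkowski.spacetime.metric.chronologicalFuture Minkowski.spacetime.timeOrientation.reverse O
    exact chronologicalFuture_mono (M := Minkowski.spacetime.carrier) (singleton_subset_iff.mpr hmem) h1

/-- The reversed chart is a late-time chart into `O` after `τ₀ = 0`. -/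
theorem isLateChart_Φ : Minkowski.spacetime.IsLateChart (Minkowski.backgroundOn ⊤) O 0 Φ := by
  refine ⟨?_, ?_, ?_⟩
  · exact T.contDiff.contMDiff.comp contMDiff_subtype_val
  · have hlate : IsOpen ((Minkowski.backgroundOn ⊤).lateRegion 0) :=
      isOpen_lt continuous_const ((PiLp.continuous_apply 2 _ 0).comp continuous_subtype_val)
    exact Tequiv.toHomeomorph.isOpenEmbedding.comp
      ((IsOpen.isOpenEmbedding_subtypeVal (⊤ : Opens E4).isOpen).comp
        (IsOpen.isOpenEmbedding_subtypeVal hlate))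
  · intro (x : E4) hx
    have hx' : x ∈ (Φ '' (Minkowski.backgroundOn ⊤).lateRegion 0 : Set E4) := hx
    rw [image_Φ_lateRegion] at hx'
    have : x 0 < -0 := hx'
    show x 0 < 0
    simpa using this

/-- The `N = 0` decomposition of `O = {x⁰ < 0} ⊆ ℝ⁴` by the time-reversed flat chart. -/
def decomp : FinalStateDecomposition Minkowski.spacetime O 2 where
  N := 0
  mass := Fin.elim0
  spin := Fin.elim0
  mass_pos i := i.elim0
  abs_spin_le_mass i := i.elim0
  motion := Fin.elim0
  τ₀ := 0
  chart i := i.elim0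
  isLateChart i := i.elim0
  tendsto_truncDeviationCk i := i.elim0
  exists_pairwise_disjoint _ := ⟨0, fun i ↦ i.elim0⟩
  excision := Fin.elim0
  tendsto_excision_div i := i.elim0
  flatDomain := ⊤
  setOf_lt_excision_subset_flatDomain _ _ := trivial
  flatChart := Φ
  isLateChart_flat := isLateChart_Φ
  tendsto_deviationCk_flat := by
    have h : ∀ τ, Minkowski.spacetime.deviationCk (Minkowski.backgroundOn ⊤) Φ 2 τ = 0 := fun τ ↦ by
      rw [Spacetime.deviationCk, deviationExtend_Φ, supCkENorm_zero]
    simp_rw [h]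
    exact tendsto_const_nhds
  diff_subset_causalPast := by
    intro (x : E4) hx
    exfalso
    apply hx.2
    refine Or.inr ?_
    have hx1 : x 0 < 0 := hx.1
    have : x ∈ (Φ '' (Minkowski.backgroundOn ⊤).lateRegion 0 : Set E4) := by
      rw [image_Φ_lateRegion]
      show x 0 < -0
      simpa using hx1
    exact this

/-- The reversed decomposition starts at `τ₀ = 0` (by `rfl`). [folklore] -/
theorem decomp_τ₀ : decomp.τ₀ = 0 := rfl
/-- The flat chart of the reversed decomposition is `Φ` (by `rfl`). [folklore] -/
theorem decomp_flatChart : decomp.flatChart = Φ := rfl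

/-- The reversed decomposition has no hole. [folklore] -/
instance : IsEmpty (Fin decomp.N) := Fin.isEmpty'

/-- The charted late region of the reversed decomposition is `O = {x⁰ < 0}`. [folklore] -/
theorem charted_decomp : decomp.charted = O := by
  rw [FinalStateDecomposition.charted, iUnion_of_empty, union_empty,
    FinalStateDecomposition.radiationZone, decomp_flatChart, decomp_τ₀]
  show (Φ '' (Minkowski.backgroundOn ⊤).lateRegion 0 : Set E4) = O
  rw [image_Φ_lateRegion]
  ext x
  show x 0 < -0 ↔ x 0 < 0
  simp

/-- `O` is its own self-determined exterior: `O = J⁺(ℝ⁴) ∩ I⁻(charted)`. [folklore] -/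
theorem O_eq : O = Minkowski.spacetime.metric.causalFuture Minkowski.spacetime.timeOrientation univ ∩
    Minkowski.spacetime.metric.chronologicalPast Minkowski.spacetime.timeOrientation decomp.charted := by
  rw [charted_decomp, chronologicalPast_O,
    univ_subset_iff.mp (LorentzianMetric.subset_causalFuture _ _ univ), univ_inter]

/-- The reversed decomposition violates exhaustion at `τ₁ = 1`: `p = (−1/2, 0) ∈ O` is neither flat-late
after `1` (that region is `{x⁰ < −1}`) nor in `J⁻(flat slab at 1) = J⁻({x⁰ = −1}) = {x⁰ ≤ −1}`. -/
theorem not_hasExhaustiveCharts_decomp : ¬ HasExhaustiveCharts decomp := by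
  -- statement revision p126844 (2026-08-16): `HasExhaustiveCharts` now opens with the honest-radii clause
  -- (`Tendsto (R i) atTop atTop ∧ max (r₊(Mᵢ,aᵢ)) 0 + 1 ≤ R i τ`); only the covering clause is used here (`N = 0`).
  rintro ⟨R, -, -, hcov⟩
  set p : E4 := (-(1 / 2 : ℝ)) • E4.basisVector 0 with hp
  have hp0 : p 0 = -(1 / 2) := by simp [hp]
  have hpO : p ∈ O := by show p 0 < 0; rw [hp0]; norm_num
  have hpF : p ∉ certifiedLate decomp R 1 := by
    rintro (h | h)
    · have h' : p ∈ (Φ '' (Minkowski.backgroundOn ⊤).lateRegion 1 : Set E4) := h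
      rw [image_Φ_lateRegion] at h'
      have : p 0 < -1 := h'
      linarith
    · obtain ⟨i, -⟩ := mem_iUnion.mp h
      exact i.elim0
  have hmem := hcov 1 (show decomp.τ₀ < 1 from one_pos) ⟨hpO, hpF⟩
  obtain ⟨q, hq, hpq⟩ := exists_mem_causalPast_singleton_of_mem_causalPast hmem
  have hle := time_le_of_mem_causalPast_singleton hpq
  rcases hq with hq | hq
  · have hq' : q ∈ (Φ '' (Minkowski.backgroundOn ⊤).timeSlab 1 : Set E4) := hq
    rw [image_Φ_timeSlab] at hq'
    have : q 0 = -1 := hq'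
    linarith
  · obtain ⟨i, -⟩ := mem_iUnion.mp hq
    exact i.elim0

end ReversedModel

end Summit.FinalStateConjecture.FinalStateConjecture.Theorems.SeamedChartsExhaust.Negative

end
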